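import Mathlib
import Summits.AnomalousDissipation.AnomalousDissipation.Theorems.SoloBlindTailOperator
import Summits.AnomalousDissipation.AnomalousDissipation.Theorems.SoloBlindTailSeedGlue

/-!
# SoloBlind — tail seeds of the explicit LEMMA-P chains (statement-layer glue for ENGINE L v1.2l)

The two semi-infinite chains of LEMMA P (PLAN §121/§125; engine `make_chains`) have the rows
`a_m x_{m-1} - β_m x_m + c_m x_{m+1}` with the common diagonal
`β_m = w + i γ (m² - 1/2)`, `w = √2 g² x + 2 ∓ i √2 κ g⁴`, `γ = g⁴` (= `TailSeedGlue.betaRow w γ m`), and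

* STREAK chain: `a_m = c_m = 1` for `m ≥ 2`;
* ROLL chain (sites `m ≥ 2`): `a_m = (m-2)/(m-1)`, `c_m = (m+2)/(m+1)`.

Engine v1.2l seeds the continued-fraction tail at a row `K` with the ball radius `amax/(b - amax - cmax)` and the
Lipschitz constant `lip0 = amax/(b - s - amax - cmax)²`, ASSERTING `amax = 1`, `cmax = c_K` (roll) / `cmax = 1` (streak)
and `inf_{m ≥ K} |β_m| = |β_K|` from `Im β_K ≥ 0`.  This file makes those assertions theorems: the roll coefficients satisfy
`0 ≤ a_m ≤ 1` (`m ≥ 2`) and `1 ≤ c_m ≤ c_K` (`m ≥ K`), so the shifted tails from any `K ≥ 2` meet the hypotheses of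
`TailSeedGlue.dominant_of_bounds` / `seed_radius` / `seed_lipschitz` with exactly the engine's constants
(`roll_tail_dominant`, `roll_seed_radius`, `roll_seed_lipschitz`, and the streak analogues with `amax = cmax = 1`).
-/

namespace Summit.AnomalousDissipation.SoloBlind.ChainTailSeed

open Summit.AnomalousDissipation.SoloBlind.TailOperator
open Summit.AnomalousDissipation.SoloBlind.TailSeedGlue

/-- Roll-chain lower coefficient `a_m = (m-2)/(m-1)` (sites `m ≥ 2`). -/
noncomputable def rollA (m : ℕ) : ℝ := ((m : ℝ) - 2) / ((m : ℝ) - 1)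

/-- Roll-chain upper coefficient `c_m = (m+2)/(m+1)`. -/
noncomputable def rollC (m : ℕ) : ℝ := ((m : ℝ) + 2) / ((m : ℝ) + 1)

/-- `0 ≤ a_m` for `m ≥ 2`. -/
theorem rollA_nonneg {m : ℕ} (hm : 2 ≤ m) : 0 ≤ rollA m := by
  have h2 : (2 : ℝ) ≤ m := by exact_mod_cast hm
  unfold rollA
  exact div_nonneg (by linarith) (by linarith)

/-- `a_m ≤ 1` for `m ≥ 2`. -/
theorem rollA_le_one {m : ℕ} (hm : 2 ≤ m) : rollA m ≤ 1 := by
  have h2 : (2 : ℝ) ≤ m := by exact_mod_cast hm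
  unfold rollA
  rw [div_le_one (by linarith)]
  linarith

/-- `0 < c_m`. -/
theorem rollC_pos (m : ℕ) : 0 < rollC m := by
  have h0 : (0 : ℝ) ≤ m := Nat.cast_nonneg m
  unfold rollC
  exact div_pos (by linarith) (by linarith)

/-- `1 ≤ c_m`. -/
theorem one_le_rollC (m : ℕ) : 1 ≤ rollC m := by
  have h0 : (0 : ℝ) ≤ m := Nat.cast_nonneg m
  unfold rollC
  rw [one_le_div (by linarith)]
  linarith

/-- `c_m = 1 + 1/(m+1)`. -/
theorem rollC_eq (m : ℕ) : rollC m = 1 + 1 / ((m : ℝ) + 1) := by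
  have h0 : (0 : ℝ) ≤ m := Nat.cast_nonneg m
  have h1 : (m : ℝ) + 1 ≠ 0 := ne_of_gt (by linarith)
  unfold rollC
  field_simp
  ring

/-- `c` is decreasing: `c_k ≤ c_m` for `m ≤ k`. -/
theorem rollC_anti {m k : ℕ} (hmk : m ≤ k) : rollC k ≤ rollC m := by
  have h0 : (0 : ℝ) ≤ m := Nat.cast_nonneg m
  have h1 : (m : ℝ) ≤ k := by exact_mod_cast hmk
  rw [rollC_eq, rollC_eq]
  have : 1 / ((k : ℝ) + 1) ≤ 1 / ((m : ℝ) + 1) :=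
    one_div_le_one_div_of_le (by linarith) (by linarith)
  linarith

/-- `‖a_m‖ ≤ 1` as a complex coefficient (`m ≥ 2`). -/
theorem norm_rollA_le {m : ℕ} (hm : 2 ≤ m) : ‖((rollA m : ℝ) : ℂ)‖ ≤ 1 := by
  rw [Complex.norm_real, Real.norm_eq_abs, abs_of_nonneg (rollA_nonneg hm)]
  exact rollA_le_one hm

/-- `‖c_m‖ ≤ c_K` as a complex coefficient (`m ≥ K`). -/
theorem norm_rollC_le {K m : ℕ} (hKm : K ≤ m) : ‖((rollC m : ℝ) : ℂ)‖ ≤ rollC K := by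
  rw [Complex.norm_real, Real.norm_eq_abs, abs_of_nonneg (rollC_pos m).le]
  exact rollC_anti hKm

/-! ### The roll tail from a seed row `K ≥ 2` -/

/-- The three coefficient bounds of the shifted ROLL tail `j ↦ (a_{K+j}, β_{K+j}, c_{K+j})`:
`b ≤ ‖β_{K+j}‖` (from `Im β_K ≥ 0`, `b ≤ ‖β_K‖`), `‖a_{K+j}‖ ≤ 1`, `‖c_{K+j}‖ ≤ c_K`. -/
theorem roll_tail_bounds (w : ℂ) {γ : ℝ} (hγ : 0 ≤ γ) {K : ℕ} (hK : 2 ≤ K) {b : ℝ}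
    (him : 0 ≤ (betaRow w γ K).im) (hb : b ≤ ‖betaRow w γ K‖) :
    (∀ j, b ≤ ‖betaRow w γ (K + j)‖) ∧ (∀ j, ‖((rollA (K + j) : ℝ) : ℂ)‖ ≤ 1) ∧
      (∀ j, ‖((rollC (K + j) : ℝ) : ℂ)‖ ≤ rollC K) :=
  ⟨fun j => hb.trans (norm_betaRow_mono w hγ (Nat.le_add_right K j) him),
    fun j => norm_rollA_le (le_trans hK (Nat.le_add_right K j)),
    fun j => norm_rollC_le (Nat.le_add_right K j)⟩

/-- **Roll tail dominance** with the engine constants `amax = 1`, `cmax = c_K`, `q = (1 + c_K)/b`. -/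
theorem roll_tail_dominant (w : ℂ) {γ : ℝ} (hγ : 0 ≤ γ) {K : ℕ} (hK : 2 ≤ K) {b : ℝ}
    (him : 0 ≤ (betaRow w γ K).im) (hb : b ≤ ‖betaRow w γ K‖) (hdom : 1 + rollC K < b) :
    Dominant (fun j => ((rollA (K + j) : ℝ) : ℂ)) (fun j => betaRow w γ (K + j))
      (fun j => ((rollC (K + j) : ℝ) : ℂ)) b ((1 + rollC K) / b) :=
  dominant_of_bounds (roll_tail_bounds w hγ hK him hb).1 (roll_tail_bounds w hγ hK him hb).2.1
    (roll_tail_bounds w hγ hK him hb).2.2 zero_le_one (rollC_pos K).le hdom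

/-- **Roll seed radius** (engine v1.2l `tail_ball`): `‖t_K‖ ≤ 1/(b - 1 - c_K)`. -/
theorem roll_seed_radius (w : ℂ) {γ : ℝ} (hγ : 0 ≤ γ) {K : ℕ} (hK : 2 ≤ K) {b : ℝ}
    (him : 0 ≤ (betaRow w γ K).im) (hb : b ≤ ‖betaRow w γ K‖) (hdom : 1 + rollC K < b) :
    ‖tval (roll_tail_dominant w hγ hK him hb hdom)‖ ≤ 1 / (b - 1 - rollC K) :=
  seed_radius (roll_tail_bounds w hγ hK him hb).1 (roll_tail_bounds w hγ hK him hb).2.1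
    (roll_tail_bounds w hγ hK him hb).2.2 zero_le_one (rollC_pos K).le hdom

/-- **Roll seed Lipschitz constant** (engine v1.2l `lip0`): for a diagonal shift `μ`, `‖μ‖ ≤ s`, with
`1 + c_K < b - s`, the two seeds differ by at most `1 · s/(b - s - 1 - c_K)²`. -/
theorem roll_seed_lipschitz (w : ℂ) {γ : ℝ} (hγ : 0 ≤ γ) {K : ℕ} (hK : 2 ≤ K) {b : ℝ}
    (him : 0 ≤ (betaRow w γ K).im) (hb : b ≤ ‖betaRow w γ K‖)
    {μ : ℂ} {s : ℝ} (hs0 : 0 ≤ s) (hμ : ‖μ‖ ≤ s) (hdom : 1 + rollC K < b - s) :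
    ∃ (hD : Dominant (fun j => ((rollA (K + j) : ℝ) : ℂ)) (fun j => betaRow w γ (K + j))
        (fun j => ((rollC (K + j) : ℝ) : ℂ)) (b - s) ((1 + rollC K) / (b - s)))
      (hD' : Dominant (fun j => ((rollA (K + j) : ℝ) : ℂ)) (fun j => betaRow w γ (K + j) + μ)
        (fun j => ((rollC (K + j) : ℝ) : ℂ)) (b - s) ((1 + rollC K) / (b - s))),
      ‖tval hD - tval hD'‖ ≤ 1 * (s / (b - s - 1 - rollC K) ^ 2) :=
  seed_lipschitz (roll_tail_bounds w hγ hK him hb).1 (roll_tail_bounds w hγ hK him hb).2.1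
    (roll_tail_bounds w hγ hK him hb).2.2 zero_le_one (rollC_pos K).le hs0 hμ hdom

/-! ### The streak tail from a seed row `K ≥ 2` (`a = c = 1`) -/

/-- The coefficient bounds of the shifted STREAK tail (`a = c = 1`). -/
theorem streak_tail_bounds (w : ℂ) {γ : ℝ} (hγ : 0 ≤ γ) {K : ℕ} {b : ℝ}
    (him : 0 ≤ (betaRow w γ K).im) (hb : b ≤ ‖betaRow w γ K‖) :
    (∀ j, b ≤ ‖betaRow w γ (K + j)‖) ∧ (∀ j : ℕ, ‖(fun _ : ℕ => (1 : ℂ)) j‖ ≤ 1) ∧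
      (∀ j : ℕ, ‖(fun _ : ℕ => (1 : ℂ)) j‖ ≤ 1) :=
  ⟨fun j => hb.trans (norm_betaRow_mono w hγ (Nat.le_add_right K j) him),
    fun j => by simp, fun j => by simp⟩

/-- **Streak tail dominance** with `amax = cmax = 1`, `q = 2/b`… stated as `(1+1)/b`. -/
theorem streak_tail_dominant (w : ℂ) {γ : ℝ} (hγ : 0 ≤ γ) {K : ℕ} {b : ℝ}
    (him : 0 ≤ (betaRow w γ K).im) (hb : b ≤ ‖betaRow w γ K‖) (hdom : 1 + 1 < b) :
    Dominant (fun _ => (1 : ℂ)) (fun j => betaRow w γ (K + j)) (fun _ => (1 : ℂ)) b ((1 + 1) / b) :=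
  dominant_of_bounds (streak_tail_bounds w hγ him hb).1 (streak_tail_bounds w hγ him hb).2.1
    (streak_tail_bounds w hγ him hb).2.2 zero_le_one zero_le_one hdom

/-- **Streak seed radius**: `‖t_K‖ ≤ 1/(b - 1 - 1)`. -/
theorem streak_seed_radius (w : ℂ) {γ : ℝ} (hγ : 0 ≤ γ) {K : ℕ} {b : ℝ}
    (him : 0 ≤ (betaRow w γ K).im) (hb : b ≤ ‖betaRow w γ K‖) (hdom : 1 + 1 < b) :
    ‖tval (streak_tail_dominant w hγ him hb hdom)‖ ≤ 1 / (b - 1 - 1) :=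
  seed_radius (streak_tail_bounds w hγ him hb).1 (streak_tail_bounds w hγ him hb).2.1
    (streak_tail_bounds w hγ him hb).2.2 zero_le_one zero_le_one hdom

/-- **Streak seed Lipschitz constant**: `‖t(β) - t(β+μ)‖ ≤ 1 · s/(b - s - 1 - 1)²` for `‖μ‖ ≤ s`, `2 < b - s`. -/
theorem streak_seed_lipschitz (w : ℂ) {γ : ℝ} (hγ : 0 ≤ γ) {K : ℕ} {b : ℝ}
    (him : 0 ≤ (betaRow w γ K).im) (hb : b ≤ ‖betaRow w γ K‖)
    {μ : ℂ} {s : ℝ} (hs0 : 0 ≤ s) (hμ : ‖μ‖ ≤ s) (hdom : 1 + 1 < b - s) :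
    ∃ (hD : Dominant (fun _ => (1 : ℂ)) (fun j => betaRow w γ (K + j)) (fun _ => (1 : ℂ))
        (b - s) ((1 + 1) / (b - s)))
      (hD' : Dominant (fun _ => (1 : ℂ)) (fun j => betaRow w γ (K + j) + μ) (fun _ => (1 : ℂ))
        (b - s) ((1 + 1) / (b - s))),
      ‖tval hD - tval hD'‖ ≤ 1 * (s / (b - s - 1 - 1) ^ 2) :=
  seed_lipschitz (streak_tail_bounds w hγ him hb).1 (streak_tail_bounds w hγ him hb).2.1
    (streak_tail_bounds w hγ him hb).2.2 zero_le_one zero_le_one hs0 hμ hdom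

end Summit.AnomalousDissipation.SoloBlind.ChainTailSeed
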